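import Literature.NumberTheory.DiophantineGeometry.SchurWeylPlethysm
import Literature.LinearAlgebra.BaseChange.PiTensorIntegralForm
import HarnessLib

/-!
# Integral forms of Weyl modules: `S_μ(𝒪^σ) ⊆ S_μ(k^σ)` is `GL(σ, 𝒪)`-stable, with congruences

Topic `NumberTheory/DiophantineGeometry`; namespace `Literature.NumberTheory.DiophantineGeometry`
(that of `SchurWeylPlethysm`, whose Weyl modules `weylModule k σ μ = c_μ · (k^σ)^{⊗d}` and Weyl
representations `weylRep` of `GL σ k` it refines).  Definitions with bodies and theorems; no named
fact, no instance, no `sorry`.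

For a subring `𝒪 ⊆ k` of a field, the algebraic representations `S_μ` of `GL_n` are DEFINED OVER
`𝒪`: Weyl's construction applied to the lattice `𝒪^σ ⊆ k^σ` gives an `𝒪`-form.  Concretely,

* `piIntForm k 𝒪 σ = 𝒪^σ ⊆ k^σ` (vectors with entries in `𝒪`), stable under matrices over `𝒪`
  (`mulVec_mem_piIntForm`), with `A v - v ∈ I • 𝒪^σ` for `A ≡ 1 (mod I)`
  (`mulVec_sub_mem_smul_piIntForm`);
* `tensorIntForm k 𝒪 σ d = (𝒪^σ)^{⊗d} ⊆ (k^σ)^{⊗d}` (the `piTensorIntForm` of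
  `Literature.LinearAlgebra.BaseChange`), stable under `glTensorRep σ k d g` for `g ∈ GL(σ, 𝒪)`
  (`glTensorRep_mem_tensorIntForm`), with `g x - x ∈ I • (𝒪^σ)^{⊗d}` for `g ≡ 1 (mod I)`
  (`glTensorRep_sub_mem_smul_tensorIntForm`), spanning over `k` and finitely generated;
* **`weylIntForm k 𝒪 σ μ = c_μ · (𝒪^σ)^{⊗d} ⊆ S_μ(k^σ)`**, the image of the integral tensors
  under the Young symmetrizer: an `𝒪`-form of the Weyl module (`span_weylIntForm_eq_top`,
  `weylIntForm_fg`) which is **stable under `GL(σ, 𝒪)`** (`weylRep_mem_weylIntForm`: the actions of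
  `k[S_d]` and `GL` commute, `SchurWeylPlethysm.asAlgebraHom_permTensorRep_comp_glTensorRep`) and on
  which **principal congruence subgroups act trivially modulo the corresponding ideal**
  (`weylRep_sub_mem_smul_weylIntForm`: `g ≡ 1 (mod I)` ⇒ `g y - y ∈ I • weylIntForm`).

This is the integral structure `M_ξ ⊆ ξ` ("a finite free `ℤ̄_p`-module … `M_ξ[p⁻¹] = M_{ξ,K} ⊗ ℚ̄_p`")
on an algebraic representation of `GL_n` used in [Scholze2015, §V.4, before Thm. V.4.1], and the
`𝒪[GL_n(𝒪_{F,p})]`-modules `M_λ` of [KhareThorne2017, §6.4]; classically, the Schur functors /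
Weyl modules are defined over `ℤ` ([FultonHarrisGTM129, §6.1 and §15.5]; Green, *Polynomial
representations of GL_n*, LNM 830, §2.6 and Ch. 5 (the `ℤ`-forms `V_{λ,ℤ}`)).  Freeness over a
principal `𝒪` and the comparison `weylIntForm ⊗_𝒪 k ≅ S_μ(k^σ)` are not needed downstream and not
recorded here.

## References

* P. Scholze, *On torsion in the cohomology of locally symmetric varieties*, Ann. of Math. 182
  (2015), §V.4 (arXiv:1306.2070, p. 66). [Scholze2015]
* C. Khare, J. A. Thorne, Amer. J. Math. 139 (2017), §6.4 (`M_λ`). [KhareThorne2017]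
* W. Fulton, J. Harris, *Representation Theory*, GTM 129, §6.1, §15.5. [FultonHarrisGTM129]
* J. A. Green, *Polynomial representations of GL_n*, LNM 830 (1980), §2.6, Ch. 5. [folklore]
-/

noncomputable section

open scoped TensorProduct Matrix
open PiTensorProduct Literature.LinearAlgebra.BaseChange

namespace Literature.NumberTheory.DiophantineGeometry

universe u v

/-! ### The lattice `𝒪^σ ⊆ k^σ` -/

section Pi

variable (k : Type u) [CommRing k] (𝒪 : Subring k) (σ : Type v)

/-- **`𝒪^σ ⊆ k^σ`**: the vectors with all entries in the subring `𝒪`, an `𝒪`-submodule (the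
standard `𝒪`-lattice of the standard representation). [folklore] -/
def piIntForm : Submodule 𝒪 (σ → k) where
  carrier := {v | ∀ r, v r ∈ 𝒪}
  zero_mem' _ := 𝒪.zero_mem
  add_mem' hv hw r := 𝒪.add_mem (hv r) (hw r)
  smul_mem' c _ hv r := 𝒪.mul_mem c.2 (hv r)

variable {k 𝒪 σ} in
/-- Membership in `𝒪^σ`. [folklore] -/
theorem mem_piIntForm_iff {v : σ → k} : v ∈ piIntForm k 𝒪 σ ↔ ∀ r, v r ∈ 𝒪 :=
  Iff.rfl

/-- `Pi.single r c ∈ 𝒪^σ` for `c ∈ 𝒪`. [folklore] -/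
theorem single_mem_piIntForm [DecidableEq σ] (r : σ) {c : k} (hc : c ∈ 𝒪) :
    (Pi.single r c : σ → k) ∈ piIntForm k 𝒪 σ := by
  intro r'
  by_cases h : r' = r
  · subst h
    rwa [Pi.single_eq_same]
  · rw [Pi.single_eq_of_ne h]
    exact 𝒪.zero_mem

/-- `𝒪^σ` spans `k^σ` over `k` (it contains the standard basis). [folklore] -/
theorem span_piIntForm_eq_top [Finite σ] :
    Submodule.span k (piIntForm k 𝒪 σ : Set (σ → k)) = ⊤ := by
  classical
  rw [eq_top_iff, ← (Pi.basisFun k σ).span_eq, Submodule.span_le]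
  rintro _ ⟨r, rfl⟩
  refine Submodule.subset_span ?_
  rw [SetLike.mem_coe, Pi.basisFun_apply]
  exact single_mem_piIntForm k 𝒪 σ r 𝒪.one_mem

/-- `𝒪^σ` is the `𝒪`-span of the standard basis. [folklore] -/
theorem piIntForm_eq_span [Fintype σ] [DecidableEq σ] :
    piIntForm k 𝒪 σ = Submodule.span 𝒪 (Set.range fun r : σ => (Pi.single r (1 : k) : σ → k)) := by
  refine le_antisymm (fun v hv => ?_) (Submodule.span_le.2 ?_)
  · rw [← Finset.univ_sum_single v]
    refine Submodule.sum_mem _ fun r _ => ?_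
    have : (Pi.single r (v r) : σ → k) = (⟨v r, hv r⟩ : 𝒪) • (Pi.single r (1 : k) : σ → k) := by
      rw [show ((⟨v r, hv r⟩ : 𝒪) • (Pi.single r (1 : k) : σ → k)) =
          (v r : k) • (Pi.single r (1 : k) : σ → k) from rfl, ← Pi.single_smul, smul_eq_mul, mul_one]
    rw [this]
    exact Submodule.smul_mem _ _ (Submodule.subset_span ⟨r, rfl⟩)
  · rintro _ ⟨r, rfl⟩
    exact single_mem_piIntForm k 𝒪 σ r 𝒪.one_mem

/-- `𝒪^σ` is finitely generated. [folklore] -/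
theorem piIntForm_fg [Finite σ] : (piIntForm k 𝒪 σ).FG := by
  classical
  cases nonempty_fintype σ
  rw [piIntForm_eq_span]
  exact Submodule.fg_span (Set.finite_range _)

/-- **Matrices over `𝒪` preserve `𝒪^σ`.** [folklore] -/
theorem mulVec_mem_piIntForm [Fintype σ] (A : Matrix σ σ 𝒪) {v : σ → k} (hv : v ∈ piIntForm k 𝒪 σ) :
    (A.map ((↑) : 𝒪 → k)) *ᵥ v ∈ piIntForm k 𝒪 σ := fun r => by
  simp only [Matrix.mulVec, dotProduct, Matrix.map_apply]
  exact sum_mem fun c _ => 𝒪.mul_mem (A r c).2 (hv c)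

/-- A vector whose entries lie in the ideal `I ⊆ 𝒪` lies in `I • 𝒪^σ`. [folklore] -/
theorem mem_smul_piIntForm_of_forall [Finite σ] (I : Ideal 𝒪) {w : σ → k}
    (hw : ∀ r, ∃ a ∈ I, (a : k) = w r) : w ∈ I • piIntForm k 𝒪 σ := by
  classical
  cases nonempty_fintype σ
  choose a ha hwa using hw
  have hw' : w = ∑ r, a r • (Pi.single r (1 : k) : σ → k) := by
    conv_lhs => rw [← Finset.univ_sum_single w]
    refine Finset.sum_congr rfl fun r _ => ?_
    rw [show (a r • (Pi.single r (1 : k) : σ → k)) = (a r : k) • (Pi.single r (1 : k) : σ → k)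
        from rfl, ← Pi.single_smul, smul_eq_mul, mul_one, hwa]
  rw [hw']
  exact Submodule.sum_mem _ fun r _ =>
    Submodule.smul_mem_smul (ha r) (single_mem_piIntForm k 𝒪 σ r 𝒪.one_mem)

/-- **Congruences on `𝒪^σ`.**  If `A ≡ 1 (mod I)` entrywise, then `A v - v ∈ I • 𝒪^σ` for
`v ∈ 𝒪^σ`. [folklore] -/
theorem mulVec_sub_mem_smul_piIntForm [Fintype σ] [DecidableEq σ] (I : Ideal 𝒪) (A : Matrix σ σ 𝒪)
    (hA : ∀ r c, A r c - (1 : Matrix σ σ 𝒪) r c ∈ I) {v : σ → k} (hv : v ∈ piIntForm k 𝒪 σ) :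
    (A.map ((↑) : 𝒪 → k)) *ᵥ v - v ∈ I • piIntForm k 𝒪 σ := by
  refine mem_smul_piIntForm_of_forall k 𝒪 σ I fun r =>
    ⟨∑ c, (A r c - (1 : Matrix σ σ 𝒪) r c) * ⟨v c, hv c⟩,
      I.sum_mem fun c _ => I.mul_mem_right _ (hA r c), ?_⟩
  have h1 : v r = ∑ c, (((1 : Matrix σ σ 𝒪) r c : 𝒪) : k) * v c := by
    rw [Finset.sum_eq_single r]
    · simp
    · intro c _ hc
      rw [Matrix.one_apply_ne (Ne.symm hc)]
      simp
    · intro h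
      exact absurd (Finset.mem_univ r) h
  rw [Pi.sub_apply, Matrix.mulVec, dotProduct, h1, ← Finset.sum_sub_distrib]
  push_cast
  refine Finset.sum_congr rfl fun c _ => ?_
  rw [Matrix.map_apply, sub_mul]

end Pi

/-! ### The lattice `(𝒪^σ)^{⊗d} ⊆ (k^σ)^{⊗d}` -/

section Tensor

variable (k : Type u) [CommRing k] (𝒪 : Subring k) (σ : Type v) (d : ℕ)

/-- **`(𝒪^σ)^{⊗d} ⊆ (k^σ)^{⊗d}`**: the `𝒪`-span of the pure tensors of integral vectors
(`piTensorIntForm` of the constant family `𝒪^σ`). [folklore] -/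
def tensorIntForm : Submodule 𝒪 (TensorPower k d (σ → k)) :=
  piTensorIntForm 𝒪 fun _ : Fin d => piIntForm k 𝒪 σ

/-- `(𝒪^σ)^{⊗d}` spans `(k^σ)^{⊗d}` over `k`. [folklore] -/
theorem span_tensorIntForm_eq_top [Finite σ] :
    Submodule.span k (tensorIntForm k 𝒪 σ d : Set (TensorPower k d (σ → k))) = ⊤ :=
  span_piTensorIntForm_eq_top fun _ => span_piIntForm_eq_top k 𝒪 σ

/-- `(𝒪^σ)^{⊗d}` is finitely generated over `𝒪`. [folklore] -/
theorem tensorIntForm_fg [Finite σ] : (tensorIntForm k 𝒪 σ d).FG :=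
  piTensorIntForm_fg fun _ => piIntForm_fg k 𝒪 σ

/-- `glTensorRep g` is the tensor power of `v ↦ g v` (`PiTensorProduct.map` of the constant family
`Matrix.mulVecLin g`). [folklore] -/
theorem glTensorRep_eq_map [Fintype σ] [DecidableEq σ] (g : GL σ k) :
    (glTensorRep σ k d g : TensorPower k d (σ → k) →ₗ[k] TensorPower k d (σ → k)) =
      PiTensorProduct.map fun _ : Fin d => Matrix.mulVecLin (g : Matrix σ σ k) := by
  refine PiTensorProduct.ext (MultilinearMap.ext fun v => ?_)
  simp only [LinearMap.compMultilinearMap_apply, glTensorRep_tprod, PiTensorProduct.map_tprod,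
    Matrix.mulVecLin_apply]

/-- The matrix of `GL(σ, f)(g)` is the entrywise image. [folklore] -/
theorem coe_generalLinearGroup_map [Fintype σ] [DecidableEq σ] (g : GL σ 𝒪) :
    ((Matrix.GeneralLinearGroup.map 𝒪.subtype g : GL σ k) : Matrix σ σ k) =
      (g : Matrix σ σ 𝒪).map ((↑) : 𝒪 → k) :=
  rfl

/-- **`(𝒪^σ)^{⊗d}` is stable under `GL(σ, 𝒪)`.** [folklore] -/
theorem glTensorRep_mem_tensorIntForm [Fintype σ] [DecidableEq σ] (g : GL σ 𝒪)
    {x : TensorPower k d (σ → k)}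
    (hx : x ∈ tensorIntForm k 𝒪 σ d) :
    glTensorRep σ k d (Matrix.GeneralLinearGroup.map 𝒪.subtype g) x ∈ tensorIntForm k 𝒪 σ d := by
  rw [glTensorRep_eq_map]
  exact map_mem_piTensorIntForm _ (fun _ v hv => by
    rw [Matrix.mulVecLin_apply, coe_generalLinearGroup_map]
    exact mulVec_mem_piIntForm k 𝒪 σ _ hv) hx

/-- **Congruences on `(𝒪^σ)^{⊗d}`.**  If `g ∈ GL(σ, 𝒪)` is `≡ 1 (mod I)` entrywise, then
`g x - x ∈ I • (𝒪^σ)^{⊗d}` for every integral tensor `x`. [folklore] -/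
theorem glTensorRep_sub_mem_smul_tensorIntForm [Fintype σ] [DecidableEq σ] (I : Ideal 𝒪) (g : GL σ 𝒪)
    (hg : ∀ r c, (g : Matrix σ σ 𝒪) r c - (1 : Matrix σ σ 𝒪) r c ∈ I)
    {x : TensorPower k d (σ → k)} (hx : x ∈ tensorIntForm k 𝒪 σ d) :
    glTensorRep σ k d (Matrix.GeneralLinearGroup.map 𝒪.subtype g) x - x ∈
      I • tensorIntForm k 𝒪 σ d := by
  rw [glTensorRep_eq_map]
  refine map_sub_mem_smul_piTensorIntForm I _ (fun _ v hv => ?_) (fun _ v hv => ?_) hx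
  · rw [Matrix.mulVecLin_apply, coe_generalLinearGroup_map]
    exact mulVec_mem_piIntForm k 𝒪 σ _ hv
  · rw [Matrix.mulVecLin_apply, coe_generalLinearGroup_map]
    exact mulVec_sub_mem_smul_piIntForm k 𝒪 σ I _ hg hv

end Tensor

/-! ### The integral form `c_μ · (𝒪^σ)^{⊗d}` of the Weyl module -/

section Weyl

variable (k : Type u) [Field k] (𝒪 : Subring k) (σ : Type v) {d : ℕ} (μ : Nat.Partition d)

/-- The Young symmetrizer `c_μ` as a `k`-linear map from the tensor power ONTO the Weyl module
`S_μ(k^σ) = c_μ · (k^σ)^{⊗d}` (Mathlib `LinearMap.rangeRestrict`). [folklore] -/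
def youngProj : TensorPower k d (σ → k) →ₗ[k] weylModule k σ μ :=
  LinearMap.rangeRestrict ((permTensorRep k (σ → k) d).asAlgebraHom (youngSymmetrizer k μ))

/-- `youngProj` is `c_μ` on the underlying tensors. [folklore] -/
@[simp]
theorem coe_youngProj_apply (x : TensorPower k d (σ → k)) :
    ((youngProj k σ μ x : weylModule k σ μ) : TensorPower k d (σ → k)) =
      (permTensorRep k (σ → k) d).asAlgebraHom (youngSymmetrizer k μ) x :=
  rfl

/-- `youngProj` is surjective onto the Weyl module. [folklore] -/
theorem youngProj_surjective : Function.Surjective (youngProj k σ μ) :=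
  LinearMap.surjective_rangeRestrict _

/-- **`c_μ` commutes with `GL`**: `g (c_μ x) = c_μ (g x)` in the Weyl module (the actions of
`k[S_d]` and `GL σ k` on the tensor power commute). [cite: FultonHarrisGTM129, Lemma 6.22] -/
theorem weylRep_youngProj [Fintype σ] [LinearOrder σ] (g : GL σ k) (x : TensorPower k d (σ → k)) :
    weylRep k σ μ g (youngProj k σ μ x) = youngProj k σ μ (glTensorRep σ k d g x) := by
  refine Subtype.ext ?_
  rw [coe_weylRep_apply, coe_youngProj_apply, coe_youngProj_apply, ← LinearMap.comp_apply,
    ← asAlgebraHom_permTensorRep_comp_glTensorRep, LinearMap.comp_apply]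

/-- **The integral form `c_μ · (𝒪^σ)^{⊗d} ⊆ S_μ(k^σ)`** of the Weyl module: the `𝒪`-submodule
spanned by the Young-symmetrised pure tensors of integral vectors, i.e. the image of `(𝒪^σ)^{⊗d}`
under `c_μ` — the lattice `M_ξ` in the algebraic representation `ξ = S_μ` of
[cite: Scholze2015, §V.4 (before Thm. V.4.1)], `M_λ` of [cite: KhareThorne2017, §6.4]; Weyl's
construction over `𝒪` [cite: FultonHarrisGTM129, §6.1 and §15.5]. -/
def weylIntForm : Submodule 𝒪 (weylModule k σ μ) :=
  (tensorIntForm k 𝒪 σ d).map ((youngProj k σ μ).restrictScalars 𝒪)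

/-- Membership: `y ∈ weylIntForm` iff `y = c_μ x` for an integral tensor `x`. [folklore] -/
theorem mem_weylIntForm_iff {y : weylModule k σ μ} :
    y ∈ weylIntForm k 𝒪 σ μ ↔ ∃ x ∈ tensorIntForm k 𝒪 σ d, youngProj k σ μ x = y :=
  Submodule.mem_map

/-- `c_μ x ∈ weylIntForm` for integral `x`. [folklore] -/
theorem youngProj_mem_weylIntForm {x : TensorPower k d (σ → k)} (hx : x ∈ tensorIntForm k 𝒪 σ d) :
    youngProj k σ μ x ∈ weylIntForm k 𝒪 σ μ :=
  Submodule.mem_map_of_mem hx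

/-- **`weylIntForm` is a `k`-form of the Weyl module**: it spans `S_μ(k^σ)` over `k`
(`M_ξ[p⁻¹] = ξ`). [cite: Scholze2015, §V.4 ("M_ξ[p⁻¹] = M_{ξ,K} ⊗ ℚ̄_p")] -/
theorem span_weylIntForm_eq_top [Finite σ] :
    Submodule.span k (weylIntForm k 𝒪 σ μ : Set (weylModule k σ μ)) = ⊤ := by
  have h : (weylIntForm k 𝒪 σ μ : Set (weylModule k σ μ)) =
      youngProj k σ μ '' (tensorIntForm k 𝒪 σ d : Set (TensorPower k d (σ → k))) := rfl
  rw [h, Submodule.span_image, span_tensorIntForm_eq_top, Submodule.map_top, LinearMap.range_eq_top]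
  exact youngProj_surjective k σ μ

/-- **`weylIntForm` is finitely generated over `𝒪`.** [folklore] -/
theorem weylIntForm_fg [Finite σ] : (weylIntForm k 𝒪 σ μ).FG :=
  (tensorIntForm_fg k 𝒪 σ d).map _

/-- **`weylIntForm` is stable under `GL(σ, 𝒪)`.** [cite: KhareThorne2017, §6.4 (M_λ is an 𝒪[GL_n(𝒪_{F,p})]-module)] -/
theorem weylRep_mem_weylIntForm [Fintype σ] [LinearOrder σ] (g : GL σ 𝒪) {y : weylModule k σ μ}
    (hy : y ∈ weylIntForm k 𝒪 σ μ) :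
    weylRep k σ μ (Matrix.GeneralLinearGroup.map 𝒪.subtype g) y ∈ weylIntForm k 𝒪 σ μ := by
  obtain ⟨x, hx, rfl⟩ := (mem_weylIntForm_iff k 𝒪 σ μ).1 hy
  have h := youngProj_mem_weylIntForm k 𝒪 σ μ (glTensorRep_mem_tensorIntForm k 𝒪 σ d g hx)
  rw [← weylRep_youngProj] at h
  exact h

/-- **Principal congruence subgroups act trivially on `weylIntForm` modulo the ideal**: if
`g ∈ GL(σ, 𝒪)` is `≡ 1 (mod I)` entrywise then `g y - y ∈ I • weylIntForm` — so a level that is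
small enough at `p` acts trivially on `M_ξ / p^m`.
[cite: Scholze2015, §V.4 (proof of Thm. V.4.1)] -/
theorem weylRep_sub_mem_smul_weylIntForm [Fintype σ] [LinearOrder σ] (I : Ideal 𝒪) (g : GL σ 𝒪)
    (hg : ∀ r c, (g : Matrix σ σ 𝒪) r c - (1 : Matrix σ σ 𝒪) r c ∈ I)
    {y : weylModule k σ μ} (hy : y ∈ weylIntForm k 𝒪 σ μ) :
    weylRep k σ μ (Matrix.GeneralLinearGroup.map 𝒪.subtype g) y - y ∈ I • weylIntForm k 𝒪 σ μ := by
  obtain ⟨x, hx, rfl⟩ := (mem_weylIntForm_iff k 𝒪 σ μ).1 hy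
  have h := Submodule.mem_map_of_mem (f := (youngProj k σ μ).restrictScalars 𝒪)
    (glTensorRep_sub_mem_smul_tensorIntForm k 𝒪 σ d I g hg hx)
  rw [Submodule.map_smul'', map_sub] at h
  change youngProj k σ μ (glTensorRep σ k d _ x) - youngProj k σ μ x ∈ I • weylIntForm k 𝒪 σ μ at h
  rw [← weylRep_youngProj] at h
  exact h

end Weyl

end Literature.NumberTheory.DiophantineGeometry
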